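import Summits.CriticalPhenomena.CardyFormulaZ2.Theorems.CardySusyWardWeakHolomorphyWeakKirchhoff

/-!
# Glue: the free staggered four-dart mode and the staggered arrival law give the weak Kirchhoff law

Line `Sketch` of the crux `CardySusyWard.WeakHolomorphy` (stmt-CriticalPhenomena-11292), skeleton v10 (lead c5,
`--supports`).  By `weakHolomorphy_iff_weakKirchhoff` the crux is the weak Kirchhoff law
`δ^{5/3} Σ_p ∂φ(z_p)·K^s_p → 0`, `K^s_p = F(c_{p,1}) + F(c_{p,3}) − F(c_{p,0}) − F(c_{p,2})` with
`F = bondDartObservable (Λ δ) δ (1/3)`, `c_{p,k} = medialCornersAt p.1 p.2 k`, `z_p = medialPoint δ (medialVertexOf p)` and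
`∂φ = (∂_xφ − i∂_yφ)/2`.  Skeleton v10 splits the signed Kirchhoff defect as
`K^s_p = 2·[s_p·in_p] − s_p·(F(c_{p,0}) + F(c_{p,1}) + F(c_{p,2}) + F(c_{p,3}))`, where `s_p = +1 / −1` at a horizontal /
vertical medial vertex and `s_p·in_p = F(c_{p,1}) + F(c_{p,3})` (horizontal), `−(F(c_{p,0}) + F(c_{p,2}))` (vertical) is the
staggered sum of the two ARRIVING dart observables.  This file is the pure bookkeeping of that split:

* `wirtingerDel_contDiff`, `wirtingerDel_hasCompactSupport`, `wirtingerDel_eq_zero_of_notMem_tsupport` — `∂φ` is a smooth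
  compactly supported weight, vanishing off `tsupport φ`;
* `two_mul_arrival_sub_fourDart_eq_kirchhoff` — the split, summed (`finsum`) against any weight supported above a finite
  vertex set, and its rearrangement `arrival_eq_half_kirchhoff_add_fourDart`;
* `stub_weakKirchhoffOfStaggeredArrival` (registered) — along a family, if the staggered four-dart mode is free (all smooth
  compactly supported weights) and the staggered arrival law holds for `φ`, then the weak Kirchhoff law holds for `φ`
  (`2·(arrival) − (four-dart mode at ψ := ∂φ)`, eventually equal above the finite vertex set of `stub_count`);
* `staggeredArrival_tendsto_iff_weakKirchhoff` — under the free-mode hypothesis the staggered arrival law and the weak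
  Kirchhoff law are EQUIVALENT, per family and test function (the same identity read as `arrival = (K^s + four-dart)/2`).

No Dobrushin-domain geometry is used: the statements hold for every mesh family `Λ : ℝ → DiscreteDobrushin`.
References: Duminil-Copin–Smirnov arXiv:1109.1549 §8.3 (Conj. 8.7); crux workfiles
`Cruxes/WeakHolomorphy/Lines/Sketch.lean` (skeleton v10).
-/

noncomputable section

namespace Summit.CriticalPhenomena.CardyFormulaZ2.Theorems.WeakHolomorphy.SplitBypass

open scoped BigOperators Topology
open Filter Set MeasureTheory Complex
open _root_.Literature.Probability.LatticeModels
open _root_.Literature.Probability.RandomPlanarGeometry (DobrushinDomain)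
open _root_.Literature.Barriers.CriticalPhenomena (medialCornersAt medialVertexOf)
open Summit.CriticalPhenomena.CardyFormulaZ2.Theorems.ParafermionPrecompact.Negative (IsFamily)

/-! ## `∂φ` is a smooth compactly supported weight -/

/-- Off the topological support of `φ` the Wirtinger derivative `∂φ(z) = (∂_xφ(z) − i ∂_yφ(z))/2` vanishes
(`fderiv` vanishes off `tsupport`). [folklore] -/
theorem wirtingerDel_eq_zero_of_notMem_tsupport (φ : ℂ → ℂ) {z : ℂ} (hz : z ∉ tsupport φ) :
    (fderiv ℝ φ z 1 - Complex.I * fderiv ℝ φ z Complex.I) / 2 = 0 := by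
  rw [fderiv_of_notMem_tsupport ℝ hz]
  simp

/-- If `∂φ(z) ≠ 0` then `z ∈ tsupport φ`. [folklore] -/
theorem mem_tsupport_of_wirtingerDel_ne_zero (φ : ℂ → ℂ) {z : ℂ}
    (hz : (fderiv ℝ φ z 1 - Complex.I * fderiv ℝ φ z Complex.I) / 2 ≠ 0) : z ∈ tsupport φ := by
  by_contra h
  exact hz (wirtingerDel_eq_zero_of_notMem_tsupport φ h)

/-- The Wirtinger derivative `∂φ = (∂_xφ − i∂_yφ)/2` of a `C^∞` function `φ : ℂ → ℂ` is `C^∞` (as a real-smooth map):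
`fderiv` of a smooth map is smooth, and evaluation at the fixed vectors `1`, `i` is linear. [folklore] -/
theorem wirtingerDel_contDiff (φ : ℂ → ℂ) (hφ : ContDiff ℝ (⊤ : ℕ∞) φ) :
    ContDiff ℝ (⊤ : ℕ∞) (fun z => (fderiv ℝ φ z 1 - Complex.I * fderiv ℝ φ z Complex.I) / 2) := by
  have hd : ContDiff ℝ (⊤ : ℕ∞) (fderiv ℝ φ) := (contDiff_infty_iff_fderiv.1 hφ).2
  have h1 : ContDiff ℝ (⊤ : ℕ∞) (fun z => fderiv ℝ φ z 1) := hd.clm_apply contDiff_const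
  have hI : ContDiff ℝ (⊤ : ℕ∞) (fun z => fderiv ℝ φ z Complex.I) := hd.clm_apply contDiff_const
  exact (h1.sub (contDiff_const.mul hI)).div_const 2

/-- The Wirtinger derivative `∂φ` of a compactly supported `φ : ℂ → ℂ` is compactly supported (its support lies in
`tsupport φ`). [folklore] -/
theorem wirtingerDel_hasCompactSupport (φ : ℂ → ℂ) (hc : HasCompactSupport φ) :
    HasCompactSupport (fun z => (fderiv ℝ φ z 1 - Complex.I * fderiv ℝ φ z Complex.I) / 2) := by
  refine hc.mono' fun z hz => ?_
  rw [Function.mem_support] at hz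
  exact mem_tsupport_of_wirtingerDel_ne_zero φ hz

/-! ## The split `K^s = 2·(s·in) − s·(four-dart sum)`, summed against a finitely supported weight -/

/-- **The v10 split, summed.** For a weight `w` whose values at the medial points `z_p` vanish outside a finite vertex set
`S`, any `Φ` on corners and any constant `c`:
`2·(c Σ_p w(z_p)·[s_p·in_p]) − c Σ_p w(z_p)·s_p·(Φ(c_{p,0})+Φ(c_{p,1})+Φ(c_{p,2})+Φ(c_{p,3}))
  = c Σ_p w(z_p)·(Φ(c_{p,1})+Φ(c_{p,3})−Φ(c_{p,0})−Φ(c_{p,2}))`,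
where `s_p·in_p = Φ(c_{p,1})+Φ(c_{p,3})` at a horizontal and `−(Φ(c_{p,0})+Φ(c_{p,2}))` at a vertical vertex (all three
`finsum`s are finite sums over `S`; pointwise `2(Φ₁+Φ₃) − ΣΦ = K^s = −2(Φ₀+Φ₂) + ΣΦ`). [folklore] -/
theorem two_mul_arrival_sub_fourDart_eq_kirchhoff (δ : ℝ) (c : ℂ) (w : ℂ → ℂ) (Φ : Site 2 × Site 2 → ℂ)
    (S : Finset (Site 2 × Fin 2)) (hw : ∀ p : Site 2 × Fin 2, w (medialPoint δ (medialVertexOf p)) ≠ 0 → p ∈ S) :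
    2 * (c * ∑ᶠ p : Site 2 × Fin 2, w (medialPoint δ (medialVertexOf p)) *
          (if p.2 = 0 then Φ (medialCornersAt p.1 p.2 1) + Φ (medialCornersAt p.1 p.2 3)
            else -(Φ (medialCornersAt p.1 p.2 0) + Φ (medialCornersAt p.1 p.2 2)))) -
      c * ∑ᶠ p : Site 2 × Fin 2, w (medialPoint δ (medialVertexOf p)) * ((if p.2 = 0 then (1 : ℂ) else -1) *
          (Φ (medialCornersAt p.1 p.2 0) + Φ (medialCornersAt p.1 p.2 1) + Φ (medialCornersAt p.1 p.2 2) +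
            Φ (medialCornersAt p.1 p.2 3))) =
    c * ∑ᶠ p : Site 2 × Fin 2, w (medialPoint δ (medialVertexOf p)) *
        (Φ (medialCornersAt p.1 p.2 1) + Φ (medialCornersAt p.1 p.2 3) - Φ (medialCornersAt p.1 p.2 0) -
          Φ (medialCornersAt p.1 p.2 2)) := by
  classical
  have key : ∀ g : Site 2 × Fin 2 → ℂ, ∑ᶠ p : Site 2 × Fin 2, w (medialPoint δ (medialVertexOf p)) * g p =
      ∑ p ∈ S, w (medialPoint δ (medialVertexOf p)) * g p := fun g => by
    refine finsum_eq_sum_of_support_subset _ fun p hp => ?_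
    rw [Function.mem_support] at hp
    exact hw p fun h0 => hp (by rw [h0, zero_mul])
  rw [key, key, key, Finset.mul_sum, Finset.mul_sum, Finset.mul_sum, Finset.mul_sum, ← Finset.sum_sub_distrib]
  refine Finset.sum_congr rfl fun p _ => ?_
  split_ifs <;> ring

/-- **The v10 split, rearranged**: under the same finiteness, `c Σ_p w(z_p)·[s_p·in_p]` is half of
`c Σ_p w(z_p)·K^s_p + c Σ_p w(z_p)·s_p·(four-dart sum)`. [folklore] -/
theorem arrival_eq_half_kirchhoff_add_fourDart (δ : ℝ) (c : ℂ) (w : ℂ → ℂ) (Φ : Site 2 × Site 2 → ℂ)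
    (S : Finset (Site 2 × Fin 2)) (hw : ∀ p : Site 2 × Fin 2, w (medialPoint δ (medialVertexOf p)) ≠ 0 → p ∈ S) :
    c * ∑ᶠ p : Site 2 × Fin 2, w (medialPoint δ (medialVertexOf p)) *
        (if p.2 = 0 then Φ (medialCornersAt p.1 p.2 1) + Φ (medialCornersAt p.1 p.2 3)
          else -(Φ (medialCornersAt p.1 p.2 0) + Φ (medialCornersAt p.1 p.2 2))) =
    2⁻¹ * (c * ∑ᶠ p : Site 2 × Fin 2, w (medialPoint δ (medialVertexOf p)) *
        (Φ (medialCornersAt p.1 p.2 1) + Φ (medialCornersAt p.1 p.2 3) - Φ (medialCornersAt p.1 p.2 0) -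
          Φ (medialCornersAt p.1 p.2 2)) +
      c * ∑ᶠ p : Site 2 × Fin 2, w (medialPoint δ (medialVertexOf p)) * ((if p.2 = 0 then (1 : ℂ) else -1) *
          (Φ (medialCornersAt p.1 p.2 0) + Φ (medialCornersAt p.1 p.2 1) + Φ (medialCornersAt p.1 p.2 2) +
            Φ (medialCornersAt p.1 p.2 3)))) := by
  have H := two_mul_arrival_sub_fourDart_eq_kirchhoff δ c w Φ S hw
  linear_combination (2⁻¹ : ℂ) * H

/-! ## The glue -/

/-- **`stub_weakKirchhoffOfStaggeredArrival` — glue, per family and test function.** Along an admissible family `Λ` of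
`D` and for a smooth test function `φ` compactly supported in the domain: if the staggered four-dart mode of `Λ` is free
(for all smooth compactly supported weights `ψ`, `δ^{5/3} Σ_p ψ(z_p)·s_p·Σ_k F(c_{p,k}) → 0`) and the staggered arrival
law holds for `(Λ, φ)` (`δ^{5/3} Σ_p ∂φ(z_p)·[s_p·in_p] → 0`), then the weak Kirchhoff law holds for `(Λ, φ)`:
`δ^{5/3} Σ_p ∂φ(z_p)·(F(c_{p,1}) + F(c_{p,3}) − F(c_{p,0}) − F(c_{p,2})) → 0`.  Proof: `∂φ = (∂_xφ − i∂_yφ)/2` is a smooth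
compactly supported weight (`wirtingerDel_contDiff`, `wirtingerDel_hasCompactSupport`), so the free mode applies to it, and
eventually in `δ` the Kirchhoff pairing equals `2·(arrival pairing) − (four-dart pairing at ∂φ)`
(`two_mul_arrival_sub_fourDart_eq_kirchhoff` above the finite vertex set of `stub_count` for `tsupport φ`). [folklore] -/
theorem stub_weakKirchhoffOfStaggeredArrival : ∀ (D : DobrushinDomain) (Λ : ℝ → DiscreteDobrushin), IsFamily D Λ →
    ∀ (φ : ℂ → ℂ), ContDiff ℝ (⊤ : ℕ∞) φ → HasCompactSupport φ → tsupport φ ⊆ D.carrier →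
    (∀ (ψ : ℂ → ℂ), ContDiff ℝ (⊤ : ℕ∞) ψ → HasCompactSupport ψ →
      Tendsto (fun δ : ℝ => ((δ ^ ((5:ℝ) / 3) : ℝ) : ℂ) * ∑ᶠ p : Site 2 × Fin 2,
          ψ (medialPoint δ (medialVertexOf p)) * ((if p.2 = 0 then (1 : ℂ) else -1) *
            (bondDartObservable (Λ δ) δ (1 / 3) (medialCornersAt p.1 p.2 0) +
              bondDartObservable (Λ δ) δ (1 / 3) (medialCornersAt p.1 p.2 1) +
              bondDartObservable (Λ δ) δ (1 / 3) (medialCornersAt p.1 p.2 2) +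
              bondDartObservable (Λ δ) δ (1 / 3) (medialCornersAt p.1 p.2 3))))
        (𝓝[>] 0) (𝓝 0)) →
    Tendsto (fun δ : ℝ => ((δ ^ ((5:ℝ) / 3) : ℝ) : ℂ) * ∑ᶠ p : Site 2 × Fin 2,
        (fderiv ℝ φ (medialPoint δ (medialVertexOf p)) 1 -
            Complex.I * fderiv ℝ φ (medialPoint δ (medialVertexOf p)) Complex.I) / 2 *
          (if p.2 = 0 then
              bondDartObservable (Λ δ) δ (1 / 3) (medialCornersAt p.1 p.2 1) +
                bondDartObservable (Λ δ) δ (1 / 3) (medialCornersAt p.1 p.2 3)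
            else
              -(bondDartObservable (Λ δ) δ (1 / 3) (medialCornersAt p.1 p.2 0) +
                bondDartObservable (Λ δ) δ (1 / 3) (medialCornersAt p.1 p.2 2))))
      (𝓝[>] 0) (𝓝 0) →
    Tendsto (fun δ : ℝ => ((δ ^ ((5:ℝ) / 3) : ℝ) : ℂ) * ∑ᶠ p : Site 2 × Fin 2,
        (fderiv ℝ φ (medialPoint δ (medialVertexOf p)) 1 -
            Complex.I * fderiv ℝ φ (medialPoint δ (medialVertexOf p)) Complex.I) / 2 *
          (bondDartObservable (Λ δ) δ (1 / 3) (medialCornersAt p.1 p.2 1) +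
            bondDartObservable (Λ δ) δ (1 / 3) (medialCornersAt p.1 p.2 3) -
            bondDartObservable (Λ δ) δ (1 / 3) (medialCornersAt p.1 p.2 0) -
            bondDartObservable (Λ δ) δ (1 / 3) (medialCornersAt p.1 p.2 2)))
      (𝓝[>] 0) (𝓝 0) := by
  intro _D Λ _hΛ φ hφ hc _hs hfree harr
  have h1 := hfree _ (wirtingerDel_contDiff φ hφ) (wirtingerDel_hasCompactSupport φ hc)
  have h2 := (harr.const_mul (2 : ℂ)).sub h1
  simp only [mul_zero, sub_zero] at h2
  refine h2.congr' ?_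
  obtain ⟨CN, hCN⟩ := stub_count (tsupport φ) hc.isCompact
  have E4 : ∀ᶠ δ in 𝓝[>] (0:ℝ), δ ∈ Set.Ioo (0:ℝ) 1 := Ioo_mem_nhdsGT one_pos
  filter_upwards [E4] with δ hδ
  obtain ⟨S, hS, -⟩ := hCN δ hδ.1 hδ.2.le
  exact two_mul_arrival_sub_fourDart_eq_kirchhoff δ _ (fun z => (fderiv ℝ φ z 1 - Complex.I * fderiv ℝ φ z Complex.I) / 2)
    (bondDartObservable (Λ δ) δ (1 / 3)) S
    fun p hp => hS p (Metric.self_subset_cthickening _ (mem_tsupport_of_wirtingerDel_ne_zero φ hp))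

/-- **Staggered arrival law ⟺ weak Kirchhoff law, per family and test function, given the free four-dart mode.** For a
mesh family `Λ` whose staggered four-dart mode is free (for all smooth compactly supported weights `ψ`,
`δ^{5/3} Σ_p ψ(z_p)·s_p·Σ_k F(c_{p,k}) → 0`) and a smooth compactly supported `φ`:
`δ^{5/3} Σ_p ∂φ(z_p)·[s_p·in_p] → 0` if and only if `δ^{5/3} Σ_p ∂φ(z_p)·K^s_p → 0`, because eventually in `δ`
`K^s`-pairing `= 2·(arrival pairing) − (four-dart pairing at ∂φ)` and `arrival pairing = ((K^s-pairing) + (four-dart pairing))/2`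
(`two_mul_arrival_sub_fourDart_eq_kirchhoff`, `arrival_eq_half_kirchhoff_add_fourDart`).  With `stub_staggeredFourDartFree`
this makes the staggered arrival law `stub_staggeredArrivalVanishes` crux-equivalent (`weakHolomorphy_iff_weakKirchhoff`).
No Dobrushin geometry or admissibility is needed for this bookkeeping. [folklore] -/
theorem staggeredArrival_tendsto_iff_weakKirchhoff (Λ : ℝ → DiscreteDobrushin) (φ : ℂ → ℂ)
    (hφ : ContDiff ℝ (⊤ : ℕ∞) φ) (hc : HasCompactSupport φ)
    (hfree : ∀ (ψ : ℂ → ℂ), ContDiff ℝ (⊤ : ℕ∞) ψ → HasCompactSupport ψ →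
      Tendsto (fun δ : ℝ => ((δ ^ ((5:ℝ) / 3) : ℝ) : ℂ) * ∑ᶠ p : Site 2 × Fin 2,
          ψ (medialPoint δ (medialVertexOf p)) * ((if p.2 = 0 then (1 : ℂ) else -1) *
            (bondDartObservable (Λ δ) δ (1 / 3) (medialCornersAt p.1 p.2 0) +
              bondDartObservable (Λ δ) δ (1 / 3) (medialCornersAt p.1 p.2 1) +
              bondDartObservable (Λ δ) δ (1 / 3) (medialCornersAt p.1 p.2 2) +
              bondDartObservable (Λ δ) δ (1 / 3) (medialCornersAt p.1 p.2 3))))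
        (𝓝[>] 0) (𝓝 0)) :
    Tendsto (fun δ : ℝ => ((δ ^ ((5:ℝ) / 3) : ℝ) : ℂ) * ∑ᶠ p : Site 2 × Fin 2,
        (fderiv ℝ φ (medialPoint δ (medialVertexOf p)) 1 -
            Complex.I * fderiv ℝ φ (medialPoint δ (medialVertexOf p)) Complex.I) / 2 *
          (if p.2 = 0 then
              bondDartObservable (Λ δ) δ (1 / 3) (medialCornersAt p.1 p.2 1) +
                bondDartObservable (Λ δ) δ (1 / 3) (medialCornersAt p.1 p.2 3)
            else
              -(bondDartObservable (Λ δ) δ (1 / 3) (medialCornersAt p.1 p.2 0) +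
                bondDartObservable (Λ δ) δ (1 / 3) (medialCornersAt p.1 p.2 2))))
      (𝓝[>] 0) (𝓝 0) ↔
    Tendsto (fun δ : ℝ => ((δ ^ ((5:ℝ) / 3) : ℝ) : ℂ) * ∑ᶠ p : Site 2 × Fin 2,
        (fderiv ℝ φ (medialPoint δ (medialVertexOf p)) 1 -
            Complex.I * fderiv ℝ φ (medialPoint δ (medialVertexOf p)) Complex.I) / 2 *
          (bondDartObservable (Λ δ) δ (1 / 3) (medialCornersAt p.1 p.2 1) +
            bondDartObservable (Λ δ) δ (1 / 3) (medialCornersAt p.1 p.2 3) -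
            bondDartObservable (Λ δ) δ (1 / 3) (medialCornersAt p.1 p.2 0) -
            bondDartObservable (Λ δ) δ (1 / 3) (medialCornersAt p.1 p.2 2)))
      (𝓝[>] 0) (𝓝 0) := by
  have h1 := hfree _ (wirtingerDel_contDiff φ hφ) (wirtingerDel_hasCompactSupport φ hc)
  obtain ⟨CN, hCN⟩ := stub_count (tsupport φ) hc.isCompact
  have E4 : ∀ᶠ δ in 𝓝[>] (0:ℝ), δ ∈ Set.Ioo (0:ℝ) 1 := Ioo_mem_nhdsGT one_pos
  constructor
  · intro harr
    have h2 := (harr.const_mul (2 : ℂ)).sub h1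
    simp only [mul_zero, sub_zero] at h2
    refine h2.congr' ?_
    filter_upwards [E4] with δ hδ
    obtain ⟨S, hS, -⟩ := hCN δ hδ.1 hδ.2.le
    exact two_mul_arrival_sub_fourDart_eq_kirchhoff δ _
      (fun z => (fderiv ℝ φ z 1 - Complex.I * fderiv ℝ φ z Complex.I) / 2) (bondDartObservable (Λ δ) δ (1 / 3)) S
      fun p hp => hS p (Metric.self_subset_cthickening _ (mem_tsupport_of_wirtingerDel_ne_zero φ hp))
  · intro hK
    have h2 := (hK.add h1).const_mul (2⁻¹ : ℂ)
    simp only [add_zero, mul_zero] at h2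
    refine h2.congr' ?_
    filter_upwards [E4] with δ hδ
    obtain ⟨S, hS, -⟩ := hCN δ hδ.1 hδ.2.le
    exact (arrival_eq_half_kirchhoff_add_fourDart δ _
      (fun z => (fderiv ℝ φ z 1 - Complex.I * fderiv ℝ φ z Complex.I) / 2) (bondDartObservable (Λ δ) δ (1 / 3)) S
      fun p hp => hS p (Metric.self_subset_cthickening _ (mem_tsupport_of_wirtingerDel_ne_zero φ hp))).symm

/-- **The registered glue, from the iff** (same statement as `stub_weakKirchhoffOfStaggeredArrival`, shown to be the `mp`
direction of `staggeredArrival_tendsto_iff_weakKirchhoff`; the family hypotheses are not needed). [folklore] -/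
theorem weakKirchhoff_of_staggeredArrival (Λ : ℝ → DiscreteDobrushin) (φ : ℂ → ℂ)
    (hφ : ContDiff ℝ (⊤ : ℕ∞) φ) (hc : HasCompactSupport φ)
    (hfree : ∀ (ψ : ℂ → ℂ), ContDiff ℝ (⊤ : ℕ∞) ψ → HasCompactSupport ψ →
      Tendsto (fun δ : ℝ => ((δ ^ ((5:ℝ) / 3) : ℝ) : ℂ) * ∑ᶠ p : Site 2 × Fin 2,
          ψ (medialPoint δ (medialVertexOf p)) * ((if p.2 = 0 then (1 : ℂ) else -1) *
            (bondDartObservable (Λ δ) δ (1 / 3) (medialCornersAt p.1 p.2 0) +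
              bondDartObservable (Λ δ) δ (1 / 3) (medialCornersAt p.1 p.2 1) +
              bondDartObservable (Λ δ) δ (1 / 3) (medialCornersAt p.1 p.2 2) +
              bondDartObservable (Λ δ) δ (1 / 3) (medialCornersAt p.1 p.2 3))))
        (𝓝[>] 0) (𝓝 0))
    (harr : Tendsto (fun δ : ℝ => ((δ ^ ((5:ℝ) / 3) : ℝ) : ℂ) * ∑ᶠ p : Site 2 × Fin 2,
        (fderiv ℝ φ (medialPoint δ (medialVertexOf p)) 1 -
            Complex.I * fderiv ℝ φ (medialPoint δ (medialVertexOf p)) Complex.I) / 2 *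
          (if p.2 = 0 then
              bondDartObservable (Λ δ) δ (1 / 3) (medialCornersAt p.1 p.2 1) +
                bondDartObservable (Λ δ) δ (1 / 3) (medialCornersAt p.1 p.2 3)
            else
              -(bondDartObservable (Λ δ) δ (1 / 3) (medialCornersAt p.1 p.2 0) +
                bondDartObservable (Λ δ) δ (1 / 3) (medialCornersAt p.1 p.2 2))))
      (𝓝[>] 0) (𝓝 0)) :
    Tendsto (fun δ : ℝ => ((δ ^ ((5:ℝ) / 3) : ℝ) : ℂ) * ∑ᶠ p : Site 2 × Fin 2,
        (fderiv ℝ φ (medialPoint δ (medialVertexOf p)) 1 -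
            Complex.I * fderiv ℝ φ (medialPoint δ (medialVertexOf p)) Complex.I) / 2 *
          (bondDartObservable (Λ δ) δ (1 / 3) (medialCornersAt p.1 p.2 1) +
            bondDartObservable (Λ δ) δ (1 / 3) (medialCornersAt p.1 p.2 3) -
            bondDartObservable (Λ δ) δ (1 / 3) (medialCornersAt p.1 p.2 0) -
            bondDartObservable (Λ δ) δ (1 / 3) (medialCornersAt p.1 p.2 2)))
      (𝓝[>] 0) (𝓝 0) :=
  (staggeredArrival_tendsto_iff_weakKirchhoff Λ φ hφ hc hfree).1 harr

end Summit.CriticalPhenomena.CardyFormulaZ2.Theorems.WeakHolomorphy.SplitBypass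

end
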